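import Mathlib
import HarnessLib
import HarnessLib.Audit
import Summits.FinalStateConjecture.Statement
import Summits.FinalStateConjecture.FinalStateConjecture.Theorems.LaminatedThresholdAssemblyFrame
import HarnessLib.Audit.Status.Attr

/-!
Route: LaminatedThreshold

DORMANT since 2026-08-25T03:43:56Z (reconciler: no traction for 7.3 d (last activity statement-claimed at 2026-08-17T18:59:28Z); parked, not closed — `ledger route dormant route-FinalStateConjecture-LaminatedThreshold --off` to reactiva) — unstaffed, not closed; items shared with open routes are served there. `ledger route dormant <id> --off` reactivates.

# Route LaminatedThreshold — no exit from a laminated threshold — accumulating exceptional leaves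
refute tame curve-genericity

REFUTATION ROUTE (`closes : LaminatedThreshold → TameExitsLocalise → ¬ FinalStateConjecture`). It
suffices, to refute the
summit AS RE-TYPED on 2026-08-16 (T2: genericity = tame codimension ≥ 1 along one-parameter families
on one fixed end,
`IsTameChristodoulouGeneric … 1`), to show X = A ∧ B. A (LaminatedThreshold, the dynamics): at some
exceptional admissible
datum d* the exceptional set E contains a LAMINATED (or, degenerately, fat) piece — there are a real
functional Φ on data and a
set K ∋ Φ d* of which Φ d* is a TWO-SIDED accumulation point such that, along every jointly smooth
admissible family through d*
supported in a compact set (a local kick), Φ is continuous near the base and every member whose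
Φ-value lies in K is
exceptional. B (TameExitsLocalise, the far field): an exceptional admissible datum that can be left
by a tame immersed injective
admissible curve can also be left by a compactly supported one (on a parameter window). The
lamination lemma — a connected
subset of ℝ ∖ K whose closure contains a two-sided accumulation point k* ∈ K of K is contained in
{k*} — then forbids every local exit at
d*, B forbids every tame exit, and the typed statement fails at d*. Revives card
threshold-lamination-vs-curve-genericity, whose
declining reason (domination by far-field burial under the topology-free typing) was removed by the
T2 re-type.
Lean: `LaminatedThreshold ∧ TameExitsLocalise`

## Assembly
Pure logic plus the lamination lemma, all inside the deciding theorem (Sketch.lean / glue.lean,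
`lean check` rc 0, no sorry,
2026-08-17): from LaminatedThreshold take X, d*, Φ, K; `FinalStateConjecture` at X unfolds
(`IsTameChristodoulouGeneric` =
`HasTameCodimAtLeastIn … {d ∈ 𝓓 | ¬ good d} 1`) at d* ∈ E to a tame immersed injective admissible
family with all c ≠ 0 good;
TameExitsLocalise turns it into a compactly supported exit with a window ε; LaminatedThreshold
applied to that local family gives
δ, continuity and saturation; along the punctured parameter segment t ↦ t·e₀, 0 < t < min(δ,ε)/2,
the values Φ(F′(t e₀)) avoid K
(good members carry no exceptional code), form a connected set (continuous image of an interval,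
`IsPreconnected.image`,
`IsPreconnected.Icc_subset`) and tend to Φ d* as t → 0⁺; a two-sided accumulation point of K admits
no such set unless all
values equal Φ d* ∈ K — contradiction. The refutation form is `¬ FinalStateConjecture` by name.

Rationale: WHY THIS LINE. Every one of the 44 open routes is positive-side and eight of them name "a
Cantor-like threshold lamination" as the thing that
kills them; none staffs it. The mechanism is final-state sensitivity in the sense of dynamical
systems (GrebogiEtAl1983,
McdonaldEtAl1985): a chaotic saddle of index 1 on the black-hole threshold makes the
dispersal/collapse basin boundary a
stable LAMINATION (Cantor set × codimension-one leaves, BatesLuZeng1998 for semiflows), every leaf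
consisting of eternally
critical, naked-singularity-forming data; Christodoulou's curve-genericity (unlike measure or Baire
genericity) cannot survive a
two-sided accumulation of exceptional leaves, by a one-page connectedness argument that is
kernel-checked inside `closes`.
The physics input is the 2023 finding that vacuum collapse has NO universal critical solution, with
non-DSS, family-dependent
threshold solutions and a bifurcating centre of collapse (BaumgarteEtAl2023, LedvinkaKhirnov2021),
against the clean DSS limit
cycle of every spherical model (Christodoulou1999instability, GundlachMartingarcia2007) and the
codimension-TWO fractality of the
5D cohomogeneity-two example (SzybkaChmaj2008, critical surface itself smooth). Imported: hyperbolic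
dynamics / fractal basin
boundaries (the lamination), real-line topology (the lever), gluing theory of the constraint
equations (ChruscielDelay2003,
CarlottoSchoen2014) for B. What it does that no route and no negative does: it is the first route
that can close the summit
NEGATIVELY, and it isolates the only role the far field still plays after T2 (crux B).

RANKED CRUXES. #2 LaminatedThreshold (crux) — There are a 3-manifold X, an admissible exceptional
datum d* (not good in the re-typed sense: MGHD exists ∧ every MGHD has complete sojourn-𝓘⁺ and a
sub-extremal, ray-closed, exhaustive, future-oriented Kerr decomposition), a functional Φ on initial
data sets and K ⊆ ℝ with Φ d* ∈ K a two-sided accumulation point of K, such that for every jointly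
smooth one-parameter family F through d* with admissible members agreeing with d* outside one
compact set there is δ > 0 with c ↦ Φ(F c) continuous on the δ-ball and, for ‖c‖ < δ, Φ(F c) ∈ K ⇒ F
c exceptional (card (−) branch; constant Φ = locally fat E is included). [difficulty: open-problem]
(why it might fail: Vacuum thresholds may be locally finite unions of C¹ sheets (hyperbolic DSS
critical solutions ⇒ embedded stable manifolds, no two-sided accumulation), as in every spherical
model (Christodoulou1999instability Thm 4.1); even the chaotic 5D example has a SMOOTH critical
surface (SzybkaChmaj2008).) [BaumgarteEtAl2023, SzybkaChmaj2008, GrebogiEtAl1983, McdonaldEtAl1985,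
LedvinkaKhirnov2021, BatesLuZeng1998, GundlachMartingarcia2007]
#3 TameExitsLocalise (crux) — For every X and every admissible exceptional datum d*: if some tame
(one fixed end, continuous mass, wDist-continuous at 0), immersed, injective, admissible
one-parameter family through d* has all members c ≠ 0 good, then some jointly smooth, immersed,
injective, admissible family through d* that agrees with d* outside one compact set has all members
good for 0 < ‖c‖ < ε (tame exit ⇒ compactly supported exit; the converse of LateLocalKicks' provable
local-⇒-tame packaging). [difficulty: XL] (why it might fail: Goodness of the exit members must
survive cutting off their tame-small tails (Cauchy stability + asymptotic stability of the settled
sub-extremal state; Kerr stability known only for |a| ≪ M) plus parametric compact gluing at d*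
(no-KID annuli); false if an exceptional datum exits only via its tail.) [ChruscielDelay2003,
CarlottoSchoen2014, CorvinoSchoen2006, KlainermanSzeftel2023, DafermosHolzegelRodnianskiTaylor2021,
GiorgiKlainermanSzeftel2022]

TWO-LAYER PLAN. Foreseen (filed only after a crux moves): LaminatedThreshold ⇐
ChaoticThresholdSaddle (an index-1 hyperbolic basic set Λ,
not a single orbit, of the renormalised vacuum flow at the black-hole threshold — a horseshoe
generated by heteroclinic
switching between the centred and the off-centre critical solutions seen as the "bifurcation of the
collapse centre" in
BaumgarteEtAl2023) → StableLeavesLaminate (Bates–Lu–Zeng stable lamination of Λ in the smooth-data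
phase space: W^s(Λ) is
locally Cantor × codimension-one disc with a transversal coordinate Φ continuous along jointly
smooth local families) →
ThresholdLeavesAreNaked (data on W^s(Λ) are eternally critical: some MGHD has a zero-mass first
singular point whose Cauchy
horizon reaches arbitrarily large radii, hence incomplete sojourn-𝓘⁺; the far field cannot clothe
it) → LaminatedThreshold.
TameExitsLocalise ⇐ ParametricCompactGluing (Chruściel–Delay / Carlotto–Schoen gluing of F c to d*
outside a fixed compact set,
jointly smoothly in c, immersed and injective via a radial contraction of the parameter) →
TailRobustOfGoodness (for small c ≠ 0
the glued datum is good iff F c is: Cauchy stability up to a late hyperboloid + asymptotic stability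
of the settled
sub-extremal multi-Kerr configuration under the removed small incoming tail) → TameExitsLocalise.

KILL CRITERIA. Close `refuted:LaminatedThreshold` if a theorem lands that at EVERY exceptional
admissible datum the exceptional set is, along
local kicks, contained in finitely many C¹ tame hypersurfaces with a transverse local direction
(embedded stable manifolds of
hyperbolic critical solutions + finiteness of accumulation mechanisms) — that is the positive
routes' shared hidden lemma and
its proof is the route's most useful failure. `refuted:TameExitsLocalise` (an exceptional datum
curable only through its tail)
⇒ pivot: restate crux A with saturation along all TAME families through d* (the lamination lemma is
unchanged) and drop B.
Mooted (`retire`) if the operator re-types genericity to a Baire-category or measure form, which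
laminations do not refute.
Numerically disfavoured (not closed) if uncertainty-exponent measurements along the published
Brill/Teukolsky families give
α = 1 on every family.

NOT DECOMPOSED YET. The dynamical-systems carrier (similarity coordinates at an accumulation point,
the renormalised flow as a semiflow on a Banach
scale of local data, hyperbolicity of Λ), the nakedness-locality lemma (finite-time naked points are
decided by bounded data
and cannot be clothed by tame-small far fields) and the parametric gluing are all layer-2 material;
none is typed at open
because the carrier definitions (`SelfSimilarVacuumProfile` covers exact profiles only) do not yet
exist. Anti-vacuity of crux
A's family clause (non-flat admissible data admit non-trivial compactly supported admissible
deformations, ChruscielDelay2003)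
is likewise left to provers.

CHEAPEST FALSIFIER. Numerical, not runnable on our lane (axisymmetric vacuum NR; SzybkaChmaj2008 p.
4 reports "over six dozens of processors with
the integration time measured in weeks" for the 1+1 cohomogeneity-two problem): the uncertainty
exponent α of the
collapse/dispersal boundary (GrebogiEtAl1983: fraction of ε-uncertain parameters ∝ ε^α) along the
centred A < 0 and A > 0
Brill families and the quadrupolar/hexadecapolar Teukolsky families of BaumgarteEtAl2023 /
LedvinkaKhirnov2021, which are
already finely tuned; α = 1 throughout removes crux A's only empirical support. Lookup performed
(2026-08-17,
materialised pages): SzybkaChmaj2008 p. 2 "This surface is smooth, but it contains three copies of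
the critical solution, and
the basin sets of these copies have fractal boundaries" — the only fractal threshold in print is
codimension-TWO, which weakens
but does not kill crux A; BaumgarteEtAl2023 p. 4 "there is no single, universal critical solution …
or whether vacuum collapse
requires a more fundamental departure from our understanding of critical collapse in spherical
symmetry" — the open question
this route harvests.

NUMBERS. Spherical scalar field: Choptuik echoing period Δ ≈ 3.44, mass-scaling exponent γ ≈ 0.37,
ONE unstable mode (Choptuik1993,
GundlachMartingarcia2007 §3; existence of the critical spacetime ReitererTrubowitz2019). Vacuum
Brill waves: AbrahamsEvans1993
reported Δ ≈ 0.6, γ ≈ 0.36; BaumgarteEtAl2023 (three codes): centred negative-amplitude Brill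
threshold A* = 4.696695, maximal
Kretschmann scalings with family-dependent exponents and no clear periodicity; two off-axis centres
of collapse for
equatorially symmetric families. 4+1 Bianchi-IX vacuum (SzybkaChmaj2008): uncertainty dimension 0 <
dim(S ∩ Q) < 1, varying
with the sample (multifractal), for basin boundaries INSIDE the smooth critical surface. The typed
genericity is m = 1
(`IsTameChristodoulouGeneric … 1`); the lamination lemma kills every m ≥ 1 by restriction to a line.

DEFINITION REQUESTS. None at open. Foreseen with the layer-2 split: a carrier for the renormalised
(similarity-coordinate) vacuum flow near an
accumulation point and its hyperbolic invariant sets (topic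
Summits/FinalStateConjecture/FinalStateConjecture/Theorems); cite
fact wanted: Chruściel–Delay compactly supported deformations of vacuum data off KID regions
(ChruscielDelay2003, Thm. 8.x).

Novelty: Searches (2026-08-17): `lit frontier FinalStateConjecture --since 2024` (60 rows; none on the
topology of exceptional sets);
`lit search --source s2 "fractal basin boundary critical collapse"` (12: dynamical-systems classics,
Wang 2003 cylindrical
scalar collapse); `lit search --source openalex "critical phenomena collapse gravitational waves
universality threshold"` (15:
BaumgarteEtAl2023, Baumgarte–Gundlach–Hilditch PRD 107 084012 and PRL 123 171103,
GundlachMartingarcia2007); `lit galaxy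
search --star all "fractal basin boundary gravitational collapse"` (0) and `"fractal threshold
behavior"` (0); `lit galaxy
search --star pdf "critical collapse"` (20: Sorkin CQG 28 025011, Kain PRD 99 104017, BGH 2023);
materialised reads of
arXiv:2305.17171 (pp. 2–4) and arXiv:0711.4612 (pp. 2–4); grep of all 55 Theses files and 115 idea
cards of the sub for
Cantor/laminat/horseshoe/basin: the lever occurs only in card
threshold-lamination-vs-curve-genericity (declined 2026-08-15
under the OLD typing, "revive only if genericity is re-typed with a data topology" — done by T2,
p126844) and as
kill-criterion prose in 8 positive routes; `ledger negatives` (1 unrelated refutation).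
Nearest prior art found: card threshold-lamination-vs-curve-genericity (its (−) lemma, informal);
SzybkaChmaj2008
(doi:10.1103/physrevlett.100.101102: fractal basin boundaries in vacuum collapse, but inside a
smooth critical surface);
GrebogiEtAl1983 / McdonaldEtAl1985 (final-state sensitivity ⇔ fractal basin bounda  [refs: 10.1103/physrevlett.100.101102:, 2305.17171, 0711.4612, doi:10.1103/physrevlett.100.101102, BaumgarteEtAl2023, GundlachMartingarcia2007, SzybkaChmaj2008, GrebogiEtAl1983, McdonaldEtAl1985]

Barriers (technique_class: threshold-lamination, genericity-topology, gluing): - technique_class: threshold-lamination, genericity-topology, gluing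
- Literature.Barriers.FinalStateConjecture.nakedSingularityInstability: it does not evade it; the
bet is the opposite regime — Thm 4.1 (`ChristodoulouInstabilityData.hasLinearCodimAtLeast_two`: a
linear 2-plane through every exceptional BV datum meets E only at the datum) shows NO lamination in
spherical Einstein–scalar collapse, whose threshold is the embedded stable manifold of one
hyperbolic DSS cycle; crux A bets that non-spherical VACUUM criticality is not of that type
(BaumgarteEtAl2023: no universal critical solution, non-DSS thresholds, bifurcating collapse
centre); the barrier's own scope caveats (h)–(i) (nothing is known in smooth classes,
regularity-dependent stability of naked singularities) cut both ways.
- Literature.Barriers.FinalStateConjecture.AretakisInstability: not load-bearing — extremal-horizon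
thresholds (KehleUnger2024) are a second conceivable source of accumulating exceptional leaves, but
the line neither needs nor claims them.
- Literature.Barriers.FinalStateConjecture.GregoryLaflammeInstability: not applicable in 3+1;
recorded only because the nearest fractal-threshold evidence (SzybkaChmaj2008) is 4+1-dimensional
and cohomogeneity-two, where black-string phenomenology is absent as well.
- Negatives index: one refuted statement on this summit (UniformPhotonSphereChannels,
`not_UniformPhotonSphereChannels`), unrelated; no refuted statement concerns genericity or
thresholds.

History (route lifecycle, newest last):
- 2026-08-25T03:43:56Z · DORMANT — reconciler: no traction for 7.3 d (last activity statement-claimed at 2026-08-17T18:59:28Z); parked, not closed — `ledger route dormant route-FinalStateConjectu (operator:999:3583203)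

sub-problem: FinalStateConjecture · status: dormant · opened planner-plan-novel-FinalStateConjecture-FinalSt-ff139f1f-v2-g15-0 2026-08-17T00:42:16Z · rev 0 · ledger route-FinalStateConjecture-LaminatedThreshold
GENERATED by the gate from the ledger (D-0016/17). Provers cite these decls: `theorem foo : Summit.FinalStateConjecture.FinalStateConjecture.Theses.LaminatedThreshold.<Decl> := …` in Summits/FinalStateConjecture/FinalStateConjecture/Theorems/<Name>.lean.
-/

namespace Summit.FinalStateConjecture.FinalStateConjecture.Theses.LaminatedThreshold

open scoped BigOperators Topology Manifold Classical MeasureTheory ProbabilityTheory Matrix InnerProductSpace ComplexConjugate ContinuousMap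
open Filter Set Function TopologicalSpace MeasureTheory

attribute [summit_statement] _root_.FinalStateConjecture

/-- item stmt-FinalStateConjecture-16893 · crux · rank 2 · open · by planner
why it might fail: Vacuum thresholds may be locally finite unions of C¹ sheets (hyperbolic DSS critical solutions ⇒ embedded stable manifolds, no two-sided accumulation), as in every spherical model (Christodoulou1999instability Thm 4.1); even the chaotic 5D example has a SMOOTH critical surface (SzybkaChmaj2008).
sources: BaumgarteEtAl2023, SzybkaChmaj2008, GrebogiEtAl1983, McdonaldEtAl1985, LedvinkaKhirnov2021, BatesLuZeng1998
[crux] There are a 3-manifold X, an admissible exceptional datum d* (not good in the re-typed sense: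
MGHD exists ∧ every MGHD has complete sojourn-𝓘⁺ and a sub-extremal, ray-closed, exhaustive,
future-oriented Kerr decomposition), a functional Φ on initial data sets and K ⊆ ℝ with Φ d* ∈ K a
two-sided accumulation point of K, such that for every jointly smooth one-parameter family F through
d* with admissible members agreeing with d* outside one compact set there is δ > 0 with c ↦ Φ(F c)
continuous on the δ-ball and, for ‖c‖ < δ, Φ(F c) ∈ K ⇒ F c exceptional (card (−) branch; constant Φ
= locally fat E is included). [difficulty: open-problem] -/
@[route_item "route-FinalStateConjecture-LaminatedThreshold", crux]
def LaminatedThreshold : Prop :=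
  ∃ (X : Type) (_ : TopologicalSpace X) (_ : ChartedSpace Literature.Geometry.Lorentzian.E3 X) (_ : IsManifold (𝓡 3) ((⊤ : ℕ∞) : WithTop ℕ∞) X) (_ : T2Space X) (_ : SecondCountableTopology X) (_ : ConnectedSpace X) (dstar : Literature.Geometry.Lorentzian.InitialDataSet (𝓡 3) X) (Φ : Literature.Geometry.Lorentzian.InitialDataSet (𝓡 3) X → ℝ) (K : Set ℝ), dstar ∈ Literature.Geometry.Lorentzian.admissibleVacuumData X ∧ ¬ ((∃ 𝒟 : Literature.Geometry.Lorentzian.VacuumCauchyDevelopment dstar, 𝒟.IsMaximal) ∧ ∀ 𝒟 : Literature.Geometry.Lorentzian.VacuumCauchyDevelopment dstar, 𝒟.IsMaximal → Summit.FinalStateConjecture.HasCompleteNullInfinity 𝒟.toCauchyDevelopment ∧ ∃ (O : Set 𝒟.carrier) (d : Literature.Geometry.Lorentzian.FinalStateDecomposition 𝒟.toSpacetime O 2), (∀ i, Literature.Geometry.Lorentzian.Kerr.IsSubextremal (d.mass i) (d.spin i)) ∧ O = Summit.FinalStateConjecture.exteriorOf 𝒟.toCauchyDevelopment d.charted ∧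 Summit.FinalStateConjecture.RaysStayInClosure 𝒟.toCauchyDevelopment O ∧ Summit.FinalStateConjecture.HasExhaustiveCharts d ∧ Summit.FinalStateConjecture.IsFutureOriented d) ∧ Φ dstar ∈ K ∧ (∀ ε : ℝ, 0 < ε → (K ∩ Set.Ioo (Φ dstar - ε) (Φ dstar)).Nonempty ∧ (K ∩ Set.Ioo (Φ dstar) (Φ dstar + ε)).Nonempty) ∧ ∀ F : EuclideanSpace ℝ (Fin 1) → Literature.Geometry.Lorentzian.InitialDataSet (𝓡 3) X, Literature.Geometry.Lorentzian.InitialDataSet.IsSmoothDataFamily 1 F → F 0 = dstar → (∀ c, F c ∈ Literature.Geometry.Lorentzian.admissibleVacuumData X) → (∃ C : Set X, IsCompact C ∧ ∀ c, ∀ x ∉ C, (F c).h.inner x = dstar.h.inner x ∧ (F c).k x = dstar.k x) → ∃ δ : ℝ, 0 < δ ∧ ContinuousOn (fun c ↦ Φ (F c)) (Metric.ball 0 δ) ∧ ∀ c ∈ Metric.ball (0 : EuclideanSpace ℝ (Fin 1)) δ, Φ (F c) ∈ K → ¬ ((∃ 𝒟 : Literature.Geometry.Lorentzian.VacuumCauchyDevelopment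 (F c), 𝒟.IsMaximal) ∧ ∀ 𝒟 : Literature.Geometry.Lorentzian.VacuumCauchyDevelopment (F c), 𝒟.IsMaximal → Summit.FinalStateConjecture.HasCompleteNullInfinity 𝒟.toCauchyDevelopment ∧ ∃ (O : Set 𝒟.carrier) (d : Literature.Geometry.Lorentzian.FinalStateDecomposition 𝒟.toSpacetime O 2), (∀ i, Literature.Geometry.Lorentzian.Kerr.IsSubextremal (d.mass i) (d.spin i)) ∧ O = Summit.FinalStateConjecture.exteriorOf 𝒟.toCauchyDevelopment d.charted ∧ Summit.FinalStateConjecture.RaysStayInClosure 𝒟.toCauchyDevelopment O ∧ Summit.FinalStateConjecture.HasExhaustiveCharts d ∧ Summit.FinalStateConjecture.IsFutureOriented d)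

/-- item stmt-FinalStateConjecture-16894 · crux · rank 3 · open · by planner
why it might fail: Goodness of the exit members must survive cutting off their tame-small tails (Cauchy stability + asymptotic stability of the settled sub-extremal state; Kerr stability known only for |a| ≪ M) plus parametric compact gluing at d* (no-KID annuli); false if an exceptional datum exits only via its tail.
sources: ChruscielDelay2003, CarlottoSchoen2014, CorvinoSchoen2006, KlainermanSzeftel2023, DafermosHolzegelRodnianskiTaylor2021, GiorgiKlainermanSzeftel2022
[crux] For every X and every admissible exceptional datum d*: if some tame (one fixed end,
continuous mass, wDist-continuous at 0), immersed, injective, admissible one-parameter family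
through d* has all members c ≠ 0 good, then some jointly smooth, immersed, injective, admissible
family through d* that agrees with d* outside one compact set has all members good for 0 < ‖c‖ < ε
(tame exit ⇒ compactly supported exit; the converse of LateLocalKicks' provable local-⇒-tame
packaging). [difficulty: XL] -/
@[route_item "route-FinalStateConjecture-LaminatedThreshold", crux]
def TameExitsLocalise : Prop :=
  ∀ (X : Type) [TopologicalSpace X] [ChartedSpace Literature.Geometry.Lorentzian.E3 X] [IsManifold (𝓡 3) ((⊤ : ℕ∞) : WithTop ℕ∞) X] [T2Space X] [SecondCountableTopology X] [ConnectedSpace X], ∀ dstar ∈ Literature.Geometry.Lorentzian.admissibleVacuumData X, ¬ ((∃ 𝒟 : Literature.Geometry.Lorentzian.VacuumCauchyDevelopment dstar, 𝒟.IsMaximal) ∧ ∀ 𝒟 : Literature.Geometry.Lorentzian.VacuumCauchyDevelopment dstar, 𝒟.IsMaximal → Summit.FinalStateConjecture.HasCompleteNullInfinity 𝒟.toCauchyDevelopment ∧ ∃ (O : Set 𝒟.carrier) (d : Literature.Geometry.Lorentzian.FinalStateDecomposition 𝒟.toSpacetime O 2), (∀ i, Literature.Geometry.Lorentzian.Kerr.IsSubextremal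 (d.mass i) (d.spin i)) ∧ O = Summit.FinalStateConjecture.exteriorOf 𝒟.toCauchyDevelopment d.charted ∧ Summit.FinalStateConjecture.RaysStayInClosure 𝒟.toCauchyDevelopment O ∧ Summit.FinalStateConjecture.HasExhaustiveCharts d ∧ Summit.FinalStateConjecture.IsFutureOriented d) → (∃ (e : Literature.Geometry.Lorentzian.AFEnd X) (F : EuclideanSpace ℝ (Fin 1) → Literature.Geometry.Lorentzian.InitialDataSet (𝓡 3) X), Literature.Geometry.Lorentzian.InitialDataSet.IsTameDataFamily e 1 F ∧ Literature.Geometry.Lorentzian.InitialDataSet.IsImmersedAtZero 1 F ∧ F 0 = dstar ∧ Function.Injective F ∧ (∀ c, F c ∈ Literature.Geometry.Lorentzian.admissibleVacuumData X) ∧ ∀ c, c ≠ 0 → ((∃ 𝒟 : Literature.Geometry.Lorentzian.VacuumCauchyDevelopment (F c), 𝒟.IsMaximal) ∧ ∀ 𝒟 : Literature.Geometry.Lorentzian.VacuumCauchyDevelopment (F c), 𝒟.IsMaximal → Summit.FinalStateConjecture.HasCompleteNullInfinity 𝒟.toCauchyDevelopment ∧ ∃ (O : Set 𝒟.carrier)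 (d : Literature.Geometry.Lorentzian.FinalStateDecomposition 𝒟.toSpacetime O 2), (∀ i, Literature.Geometry.Lorentzian.Kerr.IsSubextremal (d.mass i) (d.spin i)) ∧ O = Summit.FinalStateConjecture.exteriorOf 𝒟.toCauchyDevelopment d.charted ∧ Summit.FinalStateConjecture.RaysStayInClosure 𝒟.toCauchyDevelopment O ∧ Summit.FinalStateConjecture.HasExhaustiveCharts d ∧ Summit.FinalStateConjecture.IsFutureOriented d)) → ∃ F' : EuclideanSpace ℝ (Fin 1) → Literature.Geometry.Lorentzian.InitialDataSet (𝓡 3) X, Literature.Geometry.Lorentzian.InitialDataSet.IsSmoothDataFamily 1 F' ∧ Literature.Geometry.Lorentzian.InitialDataSet.IsImmersedAtZero 1 F' ∧ F' 0 = dstar ∧ Function.Injective F' ∧ (∀ c, F' c ∈ Literature.Geometry.Lorentzian.admissibleVacuumData X) ∧ (∃ C : Set X, IsCompact C ∧ ∀ c, ∀ x ∉ C, (F' c).h.inner x = dstar.h.inner x ∧ (F' c).k x = dstar.k x) ∧ ∃ ε : ℝ, 0 < ε ∧ ∀ c, c ≠ 0 → ‖c‖ < ε → ((∃ 𝒟 :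 Literature.Geometry.Lorentzian.VacuumCauchyDevelopment (F' c), 𝒟.IsMaximal) ∧ ∀ 𝒟 : Literature.Geometry.Lorentzian.VacuumCauchyDevelopment (F' c), 𝒟.IsMaximal → Summit.FinalStateConjecture.HasCompleteNullInfinity 𝒟.toCauchyDevelopment ∧ ∃ (O : Set 𝒟.carrier) (d : Literature.Geometry.Lorentzian.FinalStateDecomposition 𝒟.toSpacetime O 2), (∀ i, Literature.Geometry.Lorentzian.Kerr.IsSubextremal (d.mass i) (d.spin i)) ∧ O = Summit.FinalStateConjecture.exteriorOf 𝒟.toCauchyDevelopment d.charted ∧ Summit.FinalStateConjecture.RaysStayInClosure 𝒟.toCauchyDevelopment O ∧ Summit.FinalStateConjecture.HasExhaustiveCharts d ∧ Summit.FinalStateConjecture.IsFutureOriented d)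

/-- item stmt-FinalStateConjecture-16895 · assembly · rank 1 · closed · proved by Summit.FinalStateConjecture.FinalStateConjecture.Theorems.LaminatedThreshold.assembly_frame_proof (prover) · by planner
sources: Christodoulou1999, DafermosLuk2017
[assembly] LaminatedThreshold → TameExitsLocalise → ¬ FinalStateConjecture (literally the deciding
theorem `closes`, opened with --refutation). -/
@[route_item "route-FinalStateConjecture-LaminatedThreshold"]
def Assembly : Prop :=
  LaminatedThreshold → TameExitsLocalise → ¬ FinalStateConjecture

/-- `Assembly` holds: proved by `Summit.FinalStateConjecture.FinalStateConjecture.Theorems.LaminatedThreshold.assembly_frame_proof`. -/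
theorem Assembly_holds : Assembly := _root_.Summit.FinalStateConjecture.FinalStateConjecture.Theorems.LaminatedThreshold.assembly_frame_proof

/-! D-0027 §2.1 — DECIDING THEOREM (planner-authored via `route open/edit --closes-file`; by planner-plan-novel-FinalStateConjecture-FinalSt-ff139f1f-v2- 2026-08-17T00:42:16Z):
its hypotheses are this route's items and its conclusion the sub-problem Statement (glue_lint), and it elaborates with this file. -/

/-- Deciding theorem (refutation): the lamination lemma is proved inline (pure topology of the
real line: a connected subset of `ℝ ∖ K` accumulating at a two-sided accumulation point of `K`
is impossible). -/
@[closes "route-FinalStateConjecture-LaminatedThreshold"] theorem closes (hA : LaminatedThreshold) (hB : TameExitsLocalise) : ¬ FinalStateConjecture := by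
  obtain ⟨X, i₁, i₂, i₃, i₄, i₅, i₆, dstar, Φ, K, hD, hbad, hk, hacc, hsat⟩ := hA
  intro hFSC
  obtain ⟨e, F, hF, himm, h0, hinj, hadm, hexc⟩ := hFSC X dstar ⟨hD, hbad⟩
  obtain ⟨F', hF', -, h0', -, hadm', hC', ε, hε, hgood⟩ :=
    hB X dstar hD hbad ⟨e, F, hF, himm, h0, hinj, hadm, fun c hc ↦ by
      by_contra hP
      exact hexc c hc ⟨hadm c, hP⟩⟩
  obtain ⟨δ, hδ, hcont, hK⟩ := hsat F' hF' h0' hadm' hC'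
  -- the segment direction in the one-dimensional parameter space
  set v : EuclideanSpace ℝ (Fin 1) := EuclideanSpace.single (0 : Fin 1) (1 : ℝ) with hv
  have hnv : ‖v‖ = 1 := by simp [hv]
  have hv0 : v ≠ 0 := by
    intro h; rw [h, norm_zero] at hnv; exact zero_ne_one hnv
  set ρ : ℝ := min δ ε / 2 with hρ
  have hρpos : 0 < ρ := by positivity
  have hρδ : ρ < δ := by
    have : min δ ε ≤ δ := min_le_left _ _
    rw [hρ]; linarith
  have hρε : ρ < ε := by
    have : min δ ε ≤ ε := min_le_right _ _
    rw [hρ]; linarith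
  -- the scalar function along the segment
  set f : ℝ → ℝ := fun t ↦ Φ (F' (t • v)) with hf
  have hnorm : ∀ t : ℝ, ‖t • v‖ = |t| := fun t ↦ by
    rw [norm_smul, hnv, mul_one, Real.norm_eq_abs]
  -- values along the punctured segment avoid K (good members cannot carry an exceptional code)
  have hnotK : ∀ t ∈ Set.Ioo (0 : ℝ) ρ, f t ∉ K := by
    intro t ht hmem
    have htne : t • v ≠ 0 := smul_ne_zero (ne_of_gt ht.1) hv0
    have hball : t • v ∈ Metric.ball (0 : EuclideanSpace ℝ (Fin 1)) δ := by
      rw [mem_ball_zero_iff, hnorm, abs_of_pos ht.1]; exact ht.2.trans hρδ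
    have hlt : ‖t • v‖ < ε := by rw [hnorm, abs_of_pos ht.1]; exact ht.2.trans hρε
    exact hK (t • v) hball hmem (hgood (t • v) htne hlt)
  -- continuity of f on the segment and at 0
  have hγ : Continuous fun t : ℝ ↦ t • v := continuous_id.smul continuous_const
  have hmaps : Set.MapsTo (fun t : ℝ ↦ t • v) (Set.Ioo 0 ρ) (Metric.ball 0 δ) := by
    intro t ht
    rw [mem_ball_zero_iff, hnorm, abs_of_pos ht.1]; exact ht.2.trans hρδ
  have hfcont : ContinuousOn f (Set.Ioo 0 ρ) := hcont.comp hγ.continuousOn hmaps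
  have hf0 : f 0 = Φ dstar := by simp [hf, h0']
  have hfat : ContinuousAt f 0 := by
    have h1 : ContinuousAt (fun c ↦ Φ (F' c)) 0 :=
      (hcont 0 (Metric.mem_ball_self hδ)).continuousAt (Metric.ball_mem_nhds 0 hδ)
    have h2 : ContinuousAt (fun t : ℝ ↦ t • v) 0 := hγ.continuousAt
    have h3 := ContinuousAt.comp_of_eq (g := fun c ↦ Φ (F' c)) (f := fun t : ℝ ↦ t • v) h1 h2
      (by simp)
    simpa [hf, Function.comp_def] using h3
  have htend : Tendsto f (𝓝[>] 0) (𝓝 (Φ dstar)) := by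
    rw [← hf0]; exact tendsto_nhdsWithin_of_tendsto_nhds hfat
  -- the image of the segment is preconnected
  have hpre : IsPreconnected (f '' Set.Ioo 0 ρ) := isPreconnected_Ioo.image f hfcont
  -- every value on the segment equals the code of the base datum
  have hconst : ∀ t₀ ∈ Set.Ioo (0 : ℝ) ρ, f t₀ = Φ dstar := by
    intro t₀ ht₀
    rcases lt_trichotomy (f t₀) (Φ dstar) with hlt | heq | hgt
    · obtain ⟨k₁, hk₁K, hk₁⟩ := (hacc (Φ dstar - f t₀) (by linarith)).1
      have hk₁lo : f t₀ < k₁ := by have := hk₁.1; linarith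
      have hk₁hi : k₁ < Φ dstar := hk₁.2
      have hev : ∀ᶠ t in 𝓝[>] (0 : ℝ), k₁ < f t ∧ t ∈ Set.Ioo 0 ρ :=
        ((tendsto_order.1 htend).1 k₁ hk₁hi).and (Ioo_mem_nhdsGT hρpos)
      obtain ⟨t, hkt, ht⟩ := hev.exists
      have hsub : Set.Icc (f t₀) (f t) ⊆ f '' Set.Ioo 0 ρ :=
        hpre.Icc_subset (Set.mem_image_of_mem f ht₀) (Set.mem_image_of_mem f ht)
      obtain ⟨t₁, ht₁, hft₁⟩ := hsub ⟨hk₁lo.le, hkt.le⟩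
      exact absurd (hft₁ ▸ hk₁K) (hnotK t₁ ht₁)
    · exact heq
    · obtain ⟨k₁, hk₁K, hk₁⟩ := (hacc (f t₀ - Φ dstar) (by linarith)).2
      have hk₁lo : Φ dstar < k₁ := hk₁.1
      have hk₁hi : k₁ < f t₀ := by have := hk₁.2; linarith
      have hev : ∀ᶠ t in 𝓝[>] (0 : ℝ), f t < k₁ ∧ t ∈ Set.Ioo 0 ρ :=
        ((tendsto_order.1 htend).2 k₁ hk₁lo).and (Ioo_mem_nhdsGT hρpos)
      obtain ⟨t, hkt, ht⟩ := hev.exists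
      have hsub : Set.Icc (f t) (f t₀) ⊆ f '' Set.Ioo 0 ρ :=
        hpre.Icc_subset (Set.mem_image_of_mem f ht) (Set.mem_image_of_mem f ht₀)
      obtain ⟨t₁, ht₁, hft₁⟩ := hsub ⟨hkt.le, hk₁hi.le⟩
      exact absurd (hft₁ ▸ hk₁K) (hnotK t₁ ht₁)
  -- contradiction at the midpoint of the segment
  have hmid : ρ / 2 ∈ Set.Ioo (0 : ℝ) ρ := ⟨by positivity, by linarith⟩
  exact hnotK (ρ / 2) hmid ((hconst (ρ / 2) hmid).symm ▸ hk)

end Summit.FinalStateConjecture.FinalStateConjecture.Theses.LaminatedThreshold
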